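import Summits.AtomisticToContinuum.Crystallization.Theorems.OverbindingBudgetAffineCompressedCutB

/-!
# NODE 79 «CompressedCut» (lens-4 g79) — part 3 of 3 (sequel of `…OverbindingBudgetAffineCompressedCutB`)

Split for the 400-line cap by the landing lane (hand-2 g36); the module docstring of part 1 (`…OverbindingBudgetAffineCompressedCutA`) describes the whole node.  Same namespace; all FQNs unchanged.
0 sorry; standard axioms.
-/


namespace Summit.AtomisticToContinuum.Crystallization.Theorems.OverbindingBudgetAffineCompressedCut

open scoped BigOperators Classical
open Literature.MathematicalPhysics.StatisticalMechanics
open Literature.Geometry.DiscreteGeometry (IsChargeFree nearestDist nearestDist_nonneg nearestDist_le_dist)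
open Summit.AtomisticToContinuum.Crystallization.Theorems.OverbindingBudgetMisfitRegistration (Framed Reg DeepReg)
open Summit.AtomisticToContinuum.Crystallization.Theorems.OverbindingBudgetMisfitWindowStatements (InWindow offCount)
open Summit.AtomisticToContinuum.Crystallization.Theorems.OverbindingBudgetBalancedCensusStatements
open Summit.AtomisticToContinuum.Crystallization.Theorems.OverbindingBudgetAffineLadder
open Summit.AtomisticToContinuum.Crystallization.Theorems.OverbindingBudgetAffineLocalisation (pairSum two_mul_interactionEnergy_eq_pairSum
  pairSum_univ_left pairSum_univ_right card_mul_floor_le_half_pairSum)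
open Summit.AtomisticToContinuum.Crystallization.Theorems.OverbindingBudgetAffineMesoCut
open Summit.AtomisticToContinuum.Crystallization.Theorems.OverbindingBudgetAffinePhaseCut
open Summit.AtomisticToContinuum.Crystallization.Theorems.OverbindingBudgetAffineCushionCut
open Summit.AtomisticToContinuum.Crystallization.Theorems.OverbindingBudgetAffineTwinCut
open Summit.AtomisticToContinuum.Crystallization.Theorems.OverbindingBudgetAffineRunCut

variable {N : ℕ}

/-! ## §5  PROVED: `PS → KD` — the floor identity with `P` = priced sites, `w = scaleWeight`, bad pulls charged by the shell sum -/

/-- Literature's shell sum, SUB-CLASS form: inside a `δ`-separated index class `S`, `Σ_{k ∈ S, k ≠ i} |yᵢ − y_k|⁻⁶ ≤ 250·δ⁻⁶` for every `i ∈ S`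
(reindex `S` by `Fin #S` and apply `sum_inv_pow_six_le`). [Literature `sum_inv_pow_six_le`, reindexed] -/
theorem sum_inv_pow_six_le_of_sep_class {y : Fin N → EuclideanSpace ℝ (Fin 3)} (S : Finset (Fin N)) {δ : ℝ} (hδ : 0 < δ)
    (hsep : ∀ i ∈ S, ∀ j ∈ S, i ≠ j → δ ≤ dist (y i) (y j)) {i : Fin N} (hi : i ∈ S) :
    ∑ k ∈ S.erase i, (dist (y i) (y k))⁻¹ ^ 6 ≤ 250 * δ⁻¹ ^ 6 := by
  set e := S.equivFin with he
  set x : Fin S.card → EuclideanSpace ℝ (Fin 3) := fun m => y (e.symm m).1 with hx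
  have hxsep : ∀ k l : Fin S.card, k ≠ l → δ ≤ dist (x k) (x l) := by
    intro k l hkl
    apply hsep _ (e.symm k).2 _ (e.symm l).2
    intro hc
    exact hkl (e.symm.injective (Subtype.ext hc))
  have h := sum_inv_pow_six_le x hδ hxsep (e ⟨i, hi⟩)
  have hdiag : (dist (y i) (y i))⁻¹ ^ 6 = 0 := by simp
  have hfull : ∑ k ∈ S.erase i, (dist (y i) (y k))⁻¹ ^ 6 = ∑ k ∈ S, (dist (y i) (y k))⁻¹ ^ 6 :=
    Finset.sum_erase S hdiag
  have hxdiag : (dist (x (e ⟨i, hi⟩)) (x (e ⟨i, hi⟩)))⁻¹ ^ 6 = 0 := by simp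
  have hxfull : ∑ m ∈ Finset.univ.erase (e ⟨i, hi⟩), (dist (x (e ⟨i, hi⟩)) (x m))⁻¹ ^ 6 =
      ∑ m : Fin S.card, (dist (x (e ⟨i, hi⟩)) (x m))⁻¹ ^ 6 := Finset.sum_erase _ hxdiag
  rw [hxfull] at h
  have hxi : x (e ⟨i, hi⟩) = y i := by simp [hx]
  rw [hxi] at h
  have hre : ∑ m : Fin S.card, (dist (y i) (x m))⁻¹ ^ 6 = ∑ k ∈ S, (dist (y i) (y k))⁻¹ ^ 6 := by
    have h1 : ∑ m : Fin S.card, (dist (y i) (x m))⁻¹ ^ 6 = ∑ s : {k // k ∈ S}, (dist (y i) (y s.1))⁻¹ ^ 6 := by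
      rw [← e.symm.sum_comp]
    rw [h1, ← Finset.sum_coe_sort S]
  rw [hfull, ← hre]
  exact h

/-- The attractive part of a pair is at least `−d⁻⁶/6`: `−(t⁻⁶/6) ≤ V(t) − max (V t) 0` for `t > 0`. [Literature `neg_le_lennardJones_of_le`] -/
theorem neg_le_lennardJones_sub_max {t : ℝ} (ht : 0 < t) : -(1 / 6 * (t⁻¹) ^ 6) ≤ lennardJones t - max (lennardJones t) 0 := by
  rcases le_or_gt (lennardJones t) 0 with h | h
  · rw [max_eq_right h, sub_zero]
    exact neg_le_lennardJones_of_le ht le_rfl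
  · rw [max_eq_left h.le, sub_self]
    have : 0 ≤ 1 / 6 * (t⁻¹) ^ 6 := by positivity
    linarith

/-- The bad pull on the priced class: for a site `k` outside a class `P` all of whose members keep distance `≥ δ` from every other site, the
attractive parts of the pairs `(i, k)`, `i ∈ P`, total at least `−(250/6)·δ⁻⁶`. [this file] -/
theorem neg_le_sum_lennardJones_of_sep {y : Fin N → EuclideanSpace ℝ (Fin 3)} (P : Finset (Fin N)) {δ : ℝ} (hδ : 0 < δ)
    (hsep : ∀ i ∈ P, ∀ j : Fin N, i ≠ j → δ ≤ dist (y i) (y j)) {k : Fin N} (hk : k ∉ P) :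
    -(250 / 6 * δ⁻¹ ^ 6) ≤ ∑ i ∈ P, (lennardJones (dist (y i) (y k)) - max (lennardJones (dist (y i) (y k))) 0) := by
  have hsep' : ∀ i ∈ insert k P, ∀ j ∈ insert k P, i ≠ j → δ ≤ dist (y i) (y j) := by
    intro i hi j hj hij
    rcases Finset.mem_insert.1 hi with rfl | hiP
    · rcases Finset.mem_insert.1 hj with rfl | hjP
      · exact absurd rfl hij
      · rw [dist_comm]; exact hsep j hjP i (Ne.symm hij)
    · exact hsep i hiP j hij
  have h := sum_inv_pow_six_le_of_sep_class (insert k P) hδ hsep' (Finset.mem_insert_self k P)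
  rw [Finset.erase_insert hk] at h
  have hterm : ∀ i ∈ P, -(1 / 6 * (dist (y k) (y i))⁻¹ ^ 6) ≤
      lennardJones (dist (y i) (y k)) - max (lennardJones (dist (y i) (y k))) 0 := by
    intro i hi
    have hik : i ≠ k := fun h => hk (h ▸ hi)
    have hd : 0 < dist (y i) (y k) := hδ.trans_le (hsep i hi k hik)
    rw [dist_comm (y k) (y i)]
    exact neg_le_lennardJones_sub_max hd
  calc -(250 / 6 * δ⁻¹ ^ 6) ≤ -(1 / 6 * ∑ i ∈ P, (dist (y k) (y i))⁻¹ ^ 6) := by linarith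
    _ = ∑ i ∈ P, -(1 / 6 * (dist (y k) (y i))⁻¹ ^ 6) := by rw [Finset.mul_sum, ← Finset.sum_neg_distrib]
    _ ≤ ∑ i ∈ P, (lennardJones (dist (y i) (y k)) - max (lennardJones (dist (y i) (y k))) 0) := Finset.sum_le_sum hterm

/-- Counting: `#{not sound} ≤ #{not deep} + #off`. [this file] -/
theorem card_not_sound_le {ρ ε g δ : ℝ} (y : Fin N → EuclideanSpace ℝ (Fin 3)) :
    ((Finset.univ.filter fun k => ¬ Sound ρ ε g δ y k).card : ℝ) ≤ (notDeepCount ρ ε g y : ℝ) + (offCount δ 2 y : ℝ) := by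
  have h : (Finset.univ.filter fun k => ¬ Sound ρ ε g δ y k).card ≤ notDeepCount ρ ε g y + offCount δ 2 y := by
    simp only [notDeepCount, offCount, Nat.card_eq_fintype_card, Fintype.card_subtype]
    calc (Finset.univ.filter fun k => ¬ Sound ρ ε g δ y k).card
        ≤ ((Finset.univ.filter fun k => ¬ DeepReg ρ ε g y k) ∪ (Finset.univ.filter fun k => ¬ InWindow δ 2 y k)).card := by
          apply Finset.card_le_card
          intro k hk
          rw [Finset.mem_filter] at hk
          simp only [Finset.mem_union, Finset.mem_filter, Finset.mem_univ, true_and]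
          by_cases hD : DeepReg ρ ε g y k
          · right; exact fun hW => hk.2 ⟨hD, hW⟩
          · left; exact hD
      _ ≤ _ := Finset.card_union_le _ _
  exact_mod_cast h

/-- The priced count is the cardinality of the priced filter. [formal bookkeeping] -/
theorem pricedCount_eq_card {ρ ρ₁ η θ₀ s₀ s₁ ε g δ : ℝ} (y : Fin N → EuclideanSpace ℝ (Fin 3)) :
    pricedCount ρ ρ₁ η θ₀ s₀ s₁ ε g δ y = (Finset.univ.filter fun i => Priced ρ ρ₁ η θ₀ s₀ s₁ ε g δ y i).card := by
  simp only [pricedCount, Nat.card_eq_fintype_card, Fintype.card_subtype]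

/-- The load of a priced site for `P` = priced filter, `w = scaleWeight` splits as site load plus the attractive parts of the bad pairs.
[formal bookkeeping] -/
theorem load_priced_eq {ρ ρ₁ η θ₀ s₀ s₁ ε g δ : ℝ} (y : Fin N → EuclideanSpace ℝ (Fin 3)) (i : Fin N) :
    load (Finset.univ.filter fun k => Priced ρ ρ₁ η θ₀ s₀ s₁ ε g δ y k) (scaleWeight y) y i =
      siteLoad ρ ρ₁ η θ₀ s₀ s₁ ε g δ y i + ∑ k ∈ Finset.univ.filter (fun k => ¬ Sound ρ ε g δ y k),
        (lennardJones (dist (y i) (y k)) - max (lennardJones (dist (y i) (y k))) 0) := by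
  unfold load siteLoad
  have hc : (Finset.univ.filter fun k => Priced ρ ρ₁ η θ₀ s₀ s₁ ε g δ y k)ᶜ =
      (Finset.univ.filter fun k => Sound ρ ε g δ y k ∧ ¬ Priced ρ ρ₁ η θ₀ s₀ s₁ ε g δ y k) ∪
        (Finset.univ.filter fun k => ¬ Sound ρ ε g δ y k) := by
    ext k
    simp only [Finset.mem_compl, Finset.mem_filter, Finset.mem_univ, true_and, Finset.mem_union]
    constructor
    · intro hk
      by_cases hS : Sound ρ ε g δ y k
      · exact Or.inl ⟨hS, hk⟩
      · exact Or.inr hS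
    · rintro (⟨-, hk⟩ | hk)
      · exact hk
      · exact fun hP => hk hP.1
  have hd : Disjoint (Finset.univ.filter fun k => Sound ρ ε g δ y k ∧ ¬ Priced ρ ρ₁ η θ₀ s₀ s₁ ε g δ y k)
      (Finset.univ.filter fun k => ¬ Sound ρ ε g δ y k) := by
    rw [Finset.disjoint_filter]
    intro k _ hk
    exact fun h => h hk.1
  rw [hc, Finset.sum_union hd, Finset.sum_sub_distrib]
  ring

/-- **`CompressedSiteSlackAt δ → CompressedDeepAt δ`** (`0 < δ`): the floor identity with per-site slack at the priced class, bad pulls charged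
`(250/6)·δ⁻⁶` per bad site. [this file] -/
theorem compressedDeepAt_of_siteSlackAt {ρ ρ₁ η θ₀ s₀ s₁ ε g δ : ℝ} (hδ : 0 < δ) (h : CompressedSiteSlackAt ρ ρ₁ η θ₀ s₀ s₁ ε g δ) :
    CompressedDeepAt ρ ρ₁ η θ₀ s₀ s₁ ε g δ := by
  obtain ⟨c, hc, h⟩ := h
  refine ⟨c, 250 / 6 * δ⁻¹ ^ 6, hc, fun N y hy => ⟨e0, norm_e0, ?_⟩⟩
  beta_reduce
  set P : Finset (Fin N) := Finset.univ.filter fun k => Priced ρ ρ₁ η θ₀ s₀ s₁ ε g δ y k with hP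
  set B : Finset (Fin N) := Finset.univ.filter fun k => ¬ Sound ρ ε g δ y k with hB
  have hw : ∀ i ∈ P, ∀ k ∈ P, i ≠ k → scaleWeight y i k + scaleWeight y k i = 1 := by
    intro i _ k hk _
    rw [hP, Finset.mem_filter] at hk
    exact scaleWeight_add_scaleWeight i (nearestDist_pos_of_priced hδ hk.2)
  have hfloor := card_compl_mul_floor_add_sum_load_le hy P hw
  -- the loads split
  have hsplit : ∑ i ∈ P, load P (scaleWeight y) y i =
      ∑ i ∈ P, siteLoad ρ ρ₁ η θ₀ s₀ s₁ ε g δ y i +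
        ∑ i ∈ P, ∑ k ∈ B, (lennardJones (dist (y i) (y k)) - max (lennardJones (dist (y i) (y k))) 0) := by
    rw [← Finset.sum_add_distrib]
    exact Finset.sum_congr rfl fun i _ => load_priced_eq y i
  -- the sitewise law summed
  have hsite : ∑ i ∈ P, ((⨅ Q : PeriodicConfiguration 3, Q.energyPerParticle lennardJones) + c) ≤
      ∑ i ∈ P, siteLoad ρ ρ₁ η θ₀ s₀ s₁ ε g δ y i := by
    refine Finset.sum_le_sum fun i hi => ?_
    rw [hP, Finset.mem_filter] at hi
    exact h N y hy i hi.2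
  rw [Finset.sum_const, nsmul_eq_mul] at hsite
  -- the bad pulls charged
  have hsepP : ∀ i ∈ P, ∀ j : Fin N, i ≠ j → δ ≤ dist (y i) (y j) := by
    intro i hi j hij
    rw [hP, Finset.mem_filter] at hi
    exact le_dist_of_priced hi.2 hij
  have hbad : -(250 / 6 * δ⁻¹ ^ 6) * (B.card : ℝ) ≤
      ∑ i ∈ P, ∑ k ∈ B, (lennardJones (dist (y i) (y k)) - max (lennardJones (dist (y i) (y k))) 0) := by
    rw [Finset.sum_comm]
    have hk : ∀ k ∈ B, -(250 / 6 * δ⁻¹ ^ 6) ≤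
        ∑ i ∈ P, (lennardJones (dist (y i) (y k)) - max (lennardJones (dist (y i) (y k))) 0) := by
      intro k hk
      have hkP : k ∉ P := by
        rw [hB, Finset.mem_filter] at hk
        rw [hP, Finset.mem_filter]
        exact fun h => hk.2 h.2.1
      exact neg_le_sum_lennardJones_of_sep P hδ hsepP hkP
    calc -(250 / 6 * δ⁻¹ ^ 6) * (B.card : ℝ) = ∑ k ∈ B, -(250 / 6 * δ⁻¹ ^ 6) := by
          rw [Finset.sum_const, nsmul_eq_mul]; ring
      _ ≤ _ := Finset.sum_le_sum hk
  -- counts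
  have hB' : (B.card : ℝ) ≤ (notDeepCount ρ ε g y : ℝ) + (offCount δ 2 y : ℝ) := card_not_sound_le y
  have hPN : (P.card : ℝ) + (Pᶜ.card : ℝ) = N := by
    have := Finset.card_add_card_compl P
    rw [Fintype.card_fin] at this
    exact_mod_cast this
  have hcnt : (pricedCount ρ ρ₁ η θ₀ s₀ s₁ ε g δ y : ℝ) = P.card := by
    rw [pricedCount_eq_card]
  have hδ6 : 0 ≤ 250 / 6 * δ⁻¹ ^ 6 := by positivity
  have hND : (0 : ℝ) ≤ notDeepCount ρ ε g y := Nat.cast_nonneg _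
  have hOff : (0 : ℝ) ≤ offCount δ 2 y := Nat.cast_nonneg _
  have hN23 : (0 : ℝ) ≤ (N : ℝ) ^ (2 / 3 : ℝ) := Real.rpow_nonneg (Nat.cast_nonneg _) _
  have hG : 0 ≤ dilGain y + shGain e0 y := add_nonneg (dilGain_nonneg y) (shGain_nonneg _ y)
  have h1 : 250 / 6 * δ⁻¹ ^ 6 * (B.card : ℝ) ≤ 250 / 6 * δ⁻¹ ^ 6 * ((notDeepCount ρ ε g y : ℝ) + (offCount δ 2 y : ℝ)) :=
    mul_le_mul_of_nonneg_left hB' hδ6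
  have h2 : 0 ≤ 250 / 6 * δ⁻¹ ^ 6 * (N : ℝ) ^ (2 / 3 : ℝ) := mul_nonneg hδ6 hN23
  have h3 : 0 ≤ 250 / 6 * δ⁻¹ ^ 6 * (dilGain y + shGain e0 y) := mul_nonneg hδ6 hG
  have hNe : (N : ℝ) * (⨅ Q : PeriodicConfiguration 3, Q.energyPerParticle lennardJones) =
      (P.card : ℝ) * (⨅ Q : PeriodicConfiguration 3, Q.energyPerParticle lennardJones) +
        (Pᶜ.card : ℝ) * (⨅ Q : PeriodicConfiguration 3, Q.energyPerParticle lennardJones) := by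
    rw [← hPN]; ring
  have hPe : (P.card : ℝ) * ((⨅ Q : PeriodicConfiguration 3, Q.energyPerParticle lennardJones) + c) =
      (P.card : ℝ) * (⨅ Q : PeriodicConfiguration 3, Q.energyPerParticle lennardJones) + c * (P.card : ℝ) := by ring
  rw [hcnt, hNe]
  rw [hsplit] at hfloor
  rw [hPe] at hsite
  linarith [hfloor, hsite, hbad, h1, h2, h3]

/-- **`CompressedSiteSlack → CompressedDeep`** («PS ⇒ KD»). [this file] -/
theorem compressedDeep_of_siteSlack (h : CompressedSiteSlack) : CompressedDeep :=
  fun δ hδ hδ2 => compressedDeepAt_of_siteSlackAt hδ (h δ hδ hδ2)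

/-! ## §6  PROVED: `KD → RO` — a compressed run site is priced, or not `64`-deep, or off-window -/

/-- A census survives replacing the priced count by any count dominated by `priced + rebated + off`. [this file] -/
theorem censusW_of_le_add {A R D : ∀ {N : ℕ}, (Fin N → EuclideanSpace ℝ (Fin 3)) → ℕ} {σ₁ σ₂ : ℝ}
    (hR : ∀ {N : ℕ} (y : Fin N → EuclideanSpace ℝ (Fin 3)), R y ≤ A y + D y + offCount σ₁ σ₂ y) (h : CensusW A D σ₁ σ₂) :
    CensusW R D σ₁ σ₂ := by
  obtain ⟨c, C, hc, h⟩ := h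
  refine ⟨c, max C 0 + c, hc, fun N y hy => ?_⟩
  obtain ⟨u, hu, e⟩ := h N y hy
  refine ⟨u, hu, ?_⟩
  have hRc : (R y : ℝ) ≤ A y + D y + offCount σ₁ σ₂ y := by exact_mod_cast hR y
  have n1 : (0 : ℝ) ≤ A y := Nat.cast_nonneg _
  have n3 : (0 : ℝ) ≤ D y := Nat.cast_nonneg _
  have n5 : (0 : ℝ) ≤ offCount σ₁ σ₂ y := Nat.cast_nonneg _
  have n6 : (0 : ℝ) ≤ (N : ℝ) ^ (2 / 3 : ℝ) := Real.rpow_nonneg (Nat.cast_nonneg _) _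
  have g1 : 0 ≤ dilGain y + shGain u y := add_nonneg (dilGain_nonneg y) (shGain_nonneg _ y)
  have hC : C ≤ max C 0 := le_max_left _ _
  have hC0 : 0 ≤ max C 0 := le_max_right _ _
  nlinarith [mul_le_mul_of_nonneg_right hC n3, mul_le_mul_of_nonneg_right hC n5, mul_le_mul_of_nonneg_right hC n6,
    mul_le_mul_of_nonneg_right hC g1, mul_nonneg hc.le n3, mul_nonneg hc.le n5, mul_nonneg hc.le n6, mul_nonneg hc.le g1]

/-- Counting: `#compressedRun ≤ #priced + #{not deep} + #off` — a compressed run-interior site (affinely deep, `nn < s₁`) that is `ρ`-deep and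
in-window is priced (second class). [this file] -/
theorem compressedRunCount_le_priced_add {ρ ρ₁ η θ₀ s₀ s₁ ε g r rh δ : ℝ} (y : Fin N → EuclideanSpace ℝ (Fin 3)) :
    compressedRunCount ρ ρ₁ η θ₀ s₁ ε g r rh y ≤
      pricedCount ρ ρ₁ η θ₀ s₀ s₁ ε g δ y + notDeepCount ρ ε g y + offCount δ 2 y := by
  simp only [compressedRunCount, pricedCount, notDeepCount, offCount, Nat.card_eq_fintype_card, Fintype.card_subtype]
  calc (Finset.univ.filter fun j => ((CFramed ε g y j ∧ ∃ i : Fin N, DeepReg ρ ε g y i ∧ dist (y j) (y i) ≤ r * nearestDist y i ∧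
            HNear r ε g y i) ∧ ¬ HNear rh ε g y j) ∧ (AffDeepReg ρ₁ η θ₀ g y j ∧ nearestDist y j < s₁)).card
      ≤ (((Finset.univ.filter fun j => Priced ρ ρ₁ η θ₀ s₀ s₁ ε g δ y j) ∪ (Finset.univ.filter fun j => ¬ DeepReg ρ ε g y j)) ∪
          (Finset.univ.filter fun j => ¬ InWindow δ 2 y j)).card := by
        apply Finset.card_le_card
        intro j hj
        rw [Finset.mem_filter] at hj
        simp only [Finset.mem_union, Finset.mem_filter, Finset.mem_univ, true_and]
        by_cases hD : DeepReg ρ ε g y j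
        · by_cases hW : InWindow δ 2 y j
          · exact Or.inl (Or.inl ⟨⟨hD, hW⟩, Or.inr hj.2.2⟩)
          · exact Or.inr hW
        · exact Or.inl (Or.inr hD)
    _ ≤ ((Finset.univ.filter fun j => Priced ρ ρ₁ η θ₀ s₀ s₁ ε g δ y j) ∪ (Finset.univ.filter fun j => ¬ DeepReg ρ ε g y j)).card +
          (Finset.univ.filter fun j => ¬ InWindow δ 2 y j).card := Finset.card_union_le _ _
    _ ≤ _ := by
        have := Finset.card_union_le (Finset.univ.filter fun j => Priced ρ ρ₁ η θ₀ s₀ s₁ ε g δ y j)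
          (Finset.univ.filter fun j => ¬ DeepReg ρ ε g y j)
        omega

/-- **`CompressedDeepAt δ → BalancedCompressedRunGapW … δ 2`** (one window). [this file] -/
theorem balancedCompressedRunGapW_of_compressedDeepAt {ρ ρ₁ η θ₀ s₀ s₁ ε g r rh δ : ℝ} (h : CompressedDeepAt ρ ρ₁ η θ₀ s₀ s₁ ε g δ) :
    BalancedCompressedRunGapW ρ ρ₁ η θ₀ s₁ ε g r rh δ 2 :=
  balancedCompressedRunGapW_iff_censusW.2 (censusW_of_le_add (fun y => compressedRunCount_le_priced_add y) h)

/-- **`CompressedDeep → CompressedRun`** («KD ⇒ RO»). [this file] -/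
theorem compressedRun_of_compressedDeep (h : CompressedDeep) : CompressedRun :=
  fun δ hδ hδ2 => balancedCompressedRunGapW_of_compressedDeepAt (h δ hδ hδ2)

/-- **`CompressedSiteSlack → CompressedRun`** («PS ⇒ RO»: the target through the floor identity's per-site slack). [this file] -/
theorem compressedRun_of_siteSlack (h : CompressedSiteSlack) : CompressedRun :=
  compressedRun_of_compressedDeep (compressedDeep_of_siteSlack h)

/-- **NODE g79: `NearFieldSlack R κ → FarFieldControl R κ → CompressedRun`.** [this file] -/
theorem compressedRun_of_near_far {R κ : ℝ} (hN : NearFieldSlack R κ) (hF : FarFieldControl R κ) : CompressedRun :=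
  compressedRun_of_siteSlack (compressedSiteSlack_of_near_far hN hF)

/-- **PS from the near-field law alone** at `(R, κ) = (12, 1/25)`: the far half is `farFieldControl_12`. [this file] -/
theorem compressedSiteSlack_of_nearFieldSlack (hN : NearFieldSlack 12 (1 / 25)) : CompressedSiteSlack :=
  compressedSiteSlack_of_near_far hN farFieldControl_12

/-- **RO from the near-field law alone** — NODE LEAF FORM: `NearFieldSlack 12 (1/25) → CompressedRun`. [this file] -/
theorem compressedRun_of_nearFieldSlack (hN : NearFieldSlack 12 (1 / 25)) : CompressedRun :=
  compressedRun_of_siteSlack (compressedSiteSlack_of_nearFieldSlack hN)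

/-- PS from the near-field law on the wider ball, `(R, κ) = (24, 1/20)` (far half `farFieldControl_24`). [this file] -/
theorem compressedSiteSlack_of_nearFieldSlack24 (hN : NearFieldSlack 24 (1 / 20)) : CompressedSiteSlack :=
  compressedSiteSlack_of_near_far hN farFieldControl_24

/-- `NearFieldSlack 24 (1/20) → CompressedRun`. [this file] -/
theorem compressedRun_of_nearFieldSlack24 (hN : NearFieldSlack 24 (1 / 20)) : CompressedRun :=
  compressedRun_of_siteSlack (compressedSiteSlack_of_nearFieldSlack24 hN)

/-! ## §7  Record corollaries (RO replaced by PS, resp. by the open leaf NS(12, 1/25), in g78's sharp seam) -/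

/-- `StackSwapGain ∧ CompressedSiteSlack ∧ WildRun ∧ ThinFault ⇒ InterfaceDominance`. [this file] -/
theorem interfaceDominance_of_swap_siteSlack (hT : StackSwapGain) (hS : CompressedSiteSlack) (hX : WildRun) (hF : ThinFault) :
    InterfaceDominance :=
  interfaceDominance_of_swap_thinFault hT (compressedRun_of_siteSlack hS) hX hF

/-- `StackSwapGain ∧ NearFieldSlack 12 (1/25) ∧ WildRun ∧ ThinFault ⇒ InterfaceDominance` (the far half is proved). [this file] -/
theorem interfaceDominance_of_swap_nearFieldSlack (hT : StackSwapGain) (hN : NearFieldSlack 12 (1 / 25)) (hX : WildRun) (hF : ThinFault) :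
    InterfaceDominance :=
  interfaceDominance_of_swap_siteSlack hT (compressedSiteSlack_of_nearFieldSlack hN) hX hF

/-- MR of record from `QH ∧ RoughCubic ∧ StackSwapGain ∧ CompressedSiteSlack ∧ WildRun ∧ ThinFault`. [this file] -/
theorem affMid_record_of_swap_siteSlack (hQH : TameBalancedHexRoughGap 64 12 (1 / 10 ^ 5) (1 / 25) (3 / 50) (1 / 450) 12) (hQ : RoughCubic)
    (hT : StackSwapGain) (hS : CompressedSiteSlack) (hX : WildRun) (hF : ThinFault) :
    TameBalancedAffMidGap 64 12 (1 / 10 ^ 5) (1 / 25) (3 / 50) (1 / 450) :=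
  affMid_record_of_swap_thinFault hQH hQ hT (compressedRun_of_siteSlack hS) hX hF

/-- **RDEF cone of record** with RO discharged to the sitewise law PS. [this file] -/
theorem rdef_of_ceg_shape_swap_siteSlack_record
    (hCEG : Summit.AtomisticToContinuum.Crystallization.Theses.PricedLinkCensus.ChargedEnergyGap)
    (hSh : OverbindingBudgetTwoShellShape.TwoShellShape (1 / 100) (3 / 50) (1 / 450))
    (hQH : TameBalancedHexRoughGap 64 12 (1 / 10 ^ 5) (1 / 25) (3 / 50) (1 / 450) 12) (hQ : RoughCubic)
    (hT : StackSwapGain) (hS : CompressedSiteSlack) (hX : WildRun) (hF : ThinFault)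
    (hK : ∃ μ₁ μR : ℝ, 0 < μ₁ ∧ 0 < μR ∧ OverbindingBudgetAffineNearCluster.PureMarginStabilityAt (3 / 2000) μ₁ μR 4)
    (hA : AffineChartStraightening)
    (hE : OverbindingBudgetAffineNearCluster.NearLightSkeletonEquilibrium (3 / 2000) 4 6 (1 / 1000) 12 (1 / 25) (1 / 2000) 4 6 320 12)
    (hC : OverbindingBudgetAffineNearCluster.NearPricedCoreFloor (3 / 2000) 4 6 (1 / 1000) 12 (1 / 25) (1 / 2000) (1 / (4 * 10 ^ 7) / 4) 4 6 12)
    (hS' : OverbindingBudgetAffineNearCluster.NearPricedShellFloor (3 / 2000) 4 6 (1 / 1000) 12 (1 / 25) (1 / 2000) (1 / (4 * 10 ^ 7) / 4) 4 6 12)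
    (hV : OverbindingBudgetAffineNearCluster.ForceContentVisible (3 / 2000) 4 6 (1 / 1000) 12 (1 / 25) (1 / 2000) 4 6)
    (hN : OverbindingBudgetAffineNearCluster.NearSecondOrderFloor (3 / 2000) 4 6 (1 / 1000) 12 (1 / 25) (1 / 2000) (1 / (4 * 10 ^ 7)))
    (hFA : OverbindingBudgetAffineLocalisation.FarAggregatePricing 12 (1 / 25) (1 / 2000) (1 / (2 * 10 ^ 7)))
    (hFR : FineNonAffinity 12 (1 / 10 ^ 5) (1 / 25))
    (hTT : OverbindingBudgetGradedBareness.CleanlessExcessT) (hR : OverbindingBudgetCoherentCut.CoherentResidual 10) :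
    Summit.AtomisticToContinuum.Crystallization.Theses.OverbindingBudget.RobustDefectLimitWindows :=
  rdef_of_ceg_shape_swap_thinFault_record hCEG hSh hQH hQ hT (compressedRun_of_siteSlack hS) hX hF hK hA hE hC hS' hV hN hFA hFR hTT hR

/-- **RDEF cone of record** with RO discharged to the OPEN LEAF `NearFieldSlack 12 (1/25)` (far half proved here). [this file] -/
theorem rdef_of_ceg_shape_swap_nearFieldSlack_record
    (hCEG : Summit.AtomisticToContinuum.Crystallization.Theses.PricedLinkCensus.ChargedEnergyGap)
    (hSh : OverbindingBudgetTwoShellShape.TwoShellShape (1 / 100) (3 / 50) (1 / 450))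
    (hQH : TameBalancedHexRoughGap 64 12 (1 / 10 ^ 5) (1 / 25) (3 / 50) (1 / 450) 12) (hQ : RoughCubic)
    (hT : StackSwapGain) (hNS : NearFieldSlack 12 (1 / 25)) (hX : WildRun) (hF : ThinFault)
    (hK : ∃ μ₁ μR : ℝ, 0 < μ₁ ∧ 0 < μR ∧ OverbindingBudgetAffineNearCluster.PureMarginStabilityAt (3 / 2000) μ₁ μR 4)
    (hA : AffineChartStraightening)
    (hE : OverbindingBudgetAffineNearCluster.NearLightSkeletonEquilibrium (3 / 2000) 4 6 (1 / 1000) 12 (1 / 25) (1 / 2000) 4 6 320 12)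
    (hC : OverbindingBudgetAffineNearCluster.NearPricedCoreFloor (3 / 2000) 4 6 (1 / 1000) 12 (1 / 25) (1 / 2000) (1 / (4 * 10 ^ 7) / 4) 4 6 12)
    (hS' : OverbindingBudgetAffineNearCluster.NearPricedShellFloor (3 / 2000) 4 6 (1 / 1000) 12 (1 / 25) (1 / 2000) (1 / (4 * 10 ^ 7) / 4) 4 6 12)
    (hV : OverbindingBudgetAffineNearCluster.ForceContentVisible (3 / 2000) 4 6 (1 / 1000) 12 (1 / 25) (1 / 2000) 4 6)
    (hN : OverbindingBudgetAffineNearCluster.NearSecondOrderFloor (3 / 2000) 4 6 (1 / 1000) 12 (1 / 25) (1 / 2000) (1 / (4 * 10 ^ 7)))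
    (hFA : OverbindingBudgetAffineLocalisation.FarAggregatePricing 12 (1 / 25) (1 / 2000) (1 / (2 * 10 ^ 7)))
    (hFR : FineNonAffinity 12 (1 / 10 ^ 5) (1 / 25))
    (hTT : OverbindingBudgetGradedBareness.CleanlessExcessT) (hR : OverbindingBudgetCoherentCut.CoherentResidual 10) :
    Summit.AtomisticToContinuum.Crystallization.Theses.OverbindingBudget.RobustDefectLimitWindows :=
  rdef_of_ceg_shape_swap_siteSlack_record hCEG hSh hQH hQ hT (compressedSiteSlack_of_nearFieldSlack hNS) hX hF hK hA hE hC hS' hV hN hFA hFR hTT hR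

end Summit.AtomisticToContinuum.Crystallization.Theorems.OverbindingBudgetAffineCompressedCut
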